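import Summits.MatrixMultiplication.MatrixMultiplication.Theorems.OutsiderSandwichNoTightExchange
import HarnessLib

/-!
# No tight BORDER exchange: `⟨m⟩ ⊠ C₁^{⊠N}` does not even degenerate to `⟨m⟩ ⊠ ⟨2,2,2⟩^{⊠N}`

Route `OutsiderSandwich` (decomposition cell `decomp-mm`, lens 4 «minimal counterexample /
extremal reduction», gen 28), support for the aside leaf `BlockOneIsMM`
(stmt-MatrixMultiplication-27147).

`OutsiderSandwichNoTightExchange.not_tight` excluded a tight amortised certificate for
RESTRICTION.  The obstruction used there — «every input-leg slice of `⟨m⟩ ⊠ P^{⊠N}` is singular,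
while `⟨m⟩ ⊠ ⟨2,2,2⟩^{⊠N}` has the identity slice» — is a CLOSED, `GL³`-invariant condition
(vanishing of the determinants of all input slices), hence passes to orbit closures.  This file
carries the argument over `ℂ[ε]` (BCS (15.19) degenerations of order `h`):

**Theorem** (`not_tight_deg`). For all `N, m ≥ 1`, `⟨m⟩ ⊠ C₁^{⊠N}` does not degenerate to
`⟨m⟩ ⊠ ⟨2,2,2⟩^{⊠N}`; consequently (`succ_le_of_amortised_deg`) every amortised BORDER
certificate `⟨B⟩ ⊠ C₁^{⊠N} ⊴ ⟨m⟩ ⊠ ⟨2,2,2⟩^{⊠N}` has `B ≥ m + 1` (Kernel II-deg is `m = 1`).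

Proof.  A degeneration `(A(ε), B(ε), C(ε))·(⟨m⟩ ⊠ P^{⊠N}) = ε^h · (⟨m⟩ ⊠ ⟨2,2,2⟩^{⊠N}) + O(ε^{h+1})`
transports input slices over `ℂ[ε]` (`slice_restrict`): at the identity-pattern weight the left
side is `A(ε) · S(ε) · C(ε)ᵀ` with `S(ε)` an input slice of `⟨m⟩ ⊠ P^{⊠N}` over `ℂ[ε]`, which has the
kernel vector `ρ = ± ω` (`sliceX_mulVec_sgnX`), so `det S(ε) = 0` in the domain `ℂ[ε]`; the right
side is `ε^h (1 + ε E(ε))`, whose determinant has constant coefficient `1` after dividing by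
`ε^{h·n}` — contradiction.

## References
* D. Coppersmith, S. Winograd, *Matrix multiplication via arithmetic progressions*,
  J. Symbolic Comput. 9 (1990) 251–280, §7. [CoppersmithWinograd1990]
* P. Bürgisser, M. Clausen, M. A. Shokrollahi, *Algebraic Complexity Theory*, Springer 1997,
  (15.19)–(15.25) (degeneration of order `h`). [BurgisserClausenShokrollahi1997]
* M. Bläser, *Fast Matrix Multiplication*, Theory of Computing Library, Graduate Surveys 5 (2013),
  §6 (border rank). [Blaser2013]
-/

noncomputable section

open scoped BigOperators Matrix Polynomial

set_option linter.dupNamespace false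
set_option autoImplicit false

namespace Summit.MatrixMultiplication.MatrixMultiplication.Theorems.OutsiderSandwichNoTightBorder

open Polynomial (C X)
open Literature.Computability.AlgebraicComplexity
open Summit.MatrixMultiplication.MatrixMultiplication.Theorems.OutsiderSandwichCoupling (coupling₁)
open Summit.MatrixMultiplication.MatrixMultiplication.Theorems.OutsiderSandwichNoTightExchange
  (slice slice_apply slice_restrict J src tgt src_symm src_halves sgn sgn_add_sgn sgn_mul_self
    idWeight slice_tgt_idWeight src_restrictsTo_coupling le_of_amortised)

variable {N m : ℕ}

/-! ## 1. The source over `ℂ[ε]` and its kernel vector -/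

/-- The source `⟨m⟩ ⊠ P^{⊠N}` with constant-polynomial entries. -/
def srcX (N m : ℕ) : J N m → J N m → J N m → ℂ[X] := fun a y z => C (src N m a y z)

/-- Unfolding `srcX`. [folklore] -/
theorem srcX_apply (a y z : J N m) : srcX N m a y z = C (src N m a y z) := rfl

/-- `srcX` is symmetric in its input and output legs. [cite: CoppersmithWinograd1990, §7] -/
theorem srcX_symm (a y z : J N m) : srcX N m a y z = srcX N m a z y := by
  rw [srcX_apply, srcX_apply, src_symm N m a y z]

/-- On the support of `srcX` the first input and output letters lie in opposite halves.
[cite: CoppersmithWinograd1990, §7] -/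
theorem srcX_halves (hN : 1 ≤ N) {a y z : J N m} (h : srcX N m a y z ≠ 0) :
    (y.2 ⟨0, hN⟩).1 ≠ (z.2 ⟨0, hN⟩).1 :=
  src_halves N m hN fun h0 => h (by rw [srcX_apply, h0, map_zero])

/-- The sign of an index as a constant polynomial. -/
def sgnX (hN : 1 ≤ N) (z : J N m) : ℂ[X] := C (sgn hN z)

/-- Opposite halves have opposite signs. [folklore] -/
theorem sgnX_add_sgnX (hN : 1 ≤ N) {y z : J N m} (h : (y.2 ⟨0, hN⟩).1 ≠ (z.2 ⟨0, hN⟩).1) :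
    sgnX hN z + sgnX hN y = 0 := by
  unfold sgnX
  rw [← map_add, sgn_add_sgn hN h, map_zero]

/-- `sgnX z * sgnX z = 1`. [folklore] -/
theorem sgnX_mul_self (hN : 1 ≤ N) (z : J N m) : sgnX hN z * sgnX hN z = 1 := by
  unfold sgnX
  rw [← map_mul, sgn_mul_self, map_one]

/-- **Kernel vector over `ℂ[ε]`**: `ρ(z) = sgn z · ω(z)` is a kernel vector of every input slice of
`⟨m⟩ ⊠ P^{⊠N}` with polynomial weights. [cite: CoppersmithWinograd1990, §7] -/
theorem sliceX_mulVec_sgnX (hN : 1 ≤ N) (ω : J N m → ℂ[X]) :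
    (slice (srcX N m) ω).mulVec (fun z => sgnX hN z * ω z) = 0 := by
  funext a
  simp only [Matrix.mulVec, dotProduct, slice_apply, Pi.zero_apply, Finset.sum_mul]
  have hT : ∑ z, ∑ y, ω y * srcX N m a y z * (sgnX hN z * ω z) =
      ∑ z, ∑ y, ω y * srcX N m a y z * (sgnX hN y * ω z) := by
    rw [Finset.sum_comm]
    refine Finset.sum_congr rfl fun p _ => Finset.sum_congr rfl fun q _ => ?_
    rw [srcX_symm a p q]
    ring
  have hvan : ∀ y z, ω y * srcX N m a y z * (sgnX hN z * ω z) +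
      ω y * srcX N m a y z * (sgnX hN y * ω z) = 0 := by
    intro y z
    by_cases hs : srcX N m a y z = 0
    · rw [hs]; ring
    · have hsum := sgnX_add_sgnX hN (srcX_halves hN hs)
      calc ω y * srcX N m a y z * (sgnX hN z * ω z) + ω y * srcX N m a y z * (sgnX hN y * ω z)
          = ω y * srcX N m a y z * ω z * (sgnX hN z + sgnX hN y) := by ring
        _ = 0 := by rw [hsum, mul_zero]
  have h2 : ∑ z, ∑ y, ω y * srcX N m a y z * (sgnX hN z * ω z) +
      ∑ z, ∑ y, ω y * srcX N m a y z * (sgnX hN y * ω z) = 0 := by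
    rw [← Finset.sum_add_distrib]
    refine Finset.sum_eq_zero fun z _ => ?_
    rw [← Finset.sum_add_distrib]
    exact Finset.sum_eq_zero fun y _ => hvan y z
  rw [← hT, ← two_mul] at h2
  exact (mul_eq_zero.mp h2).resolve_left two_ne_zero

/-- **Every input slice of `⟨m⟩ ⊠ P^{⊠N}` over `ℂ[ε]` is singular** (`m ≥ 1`).
[cite: CoppersmithWinograd1990, §7] -/
theorem det_sliceX_eq_zero (hN : 1 ≤ N) (hm : 1 ≤ m) (ω : J N m → ℂ[X]) :
    (slice (srcX N m) ω).det = 0 := by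
  by_contra hdet
  have hρ := Matrix.eq_zero_of_mulVec_eq_zero hdet (sliceX_mulVec_sgnX hN ω)
  have hω : ω = 0 := by
    funext z
    have hz := congrFun hρ z
    simp only [Pi.zero_apply] at hz ⊢
    have := congrArg (fun x => sgnX hN z * x) hz
    simpa only [← mul_assoc, sgnX_mul_self, one_mul, mul_zero] using this
  have h0 : slice (srcX N m) ω = 0 := by
    ext a c; simp [slice_apply, hω]
  haveI : Nonempty (J N m) := ⟨(⟨0, hm⟩, fun _ => ((0 : Fin 2), (0 : Fin 2)))⟩
  exact hdet (by rw [h0, Matrix.det_zero])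

/-! ## 2. No tight degeneration -/

/-- **No tight border exchange at any level or multiplicity**: for `N, m ≥ 1`,
`⟨m⟩ ⊠ C₁^{⊠N}` does not degenerate (BCS (15.19), over `ℂ[ε]`) to `⟨m⟩ ⊠ ⟨2,2,2⟩^{⊠N}`.
[cite: BurgisserClausenShokrollahi1997, (15.19)] -/
theorem not_tight_deg (hN : 1 ≤ N) (hm : 1 ≤ m) :
    ¬ AlgDegeneratesTo (kroneckerTensor (unitTensor ℂ m) (kroneckerPow coupling₁ N))
        (kroneckerTensor (unitTensor ℂ m) (kroneckerPow (matMulTensor ℂ 2 2 2) N)) := by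
  intro hdeg
  obtain ⟨h, A, B, D, happ⟩ := (src_restrictsTo_coupling N m).algDegeneratesTo_trans hdeg
  -- the degenerating family `u = (A, B, D)·srcX` over `ℂ[ε]`
  set u : J N m → J N m → J N m → ℂ[X] :=
    fun a' b' c' => ∑ a, ∑ b, ∑ c, A a' a * B b' b * D c' c * srcX N m a b c with hu
  have hcoeff_u : ∀ a b c, ∀ j ≤ h, (u a b c).coeff j = if j = h then tgt N m a b c else 0 :=
    fun a b c j hj => happ a b c j hj
  -- slice transport over `ℂ[ε]` at the identity-pattern weight
  set w' : J N m → ℂ[X] := fun x => C (idWeight N m x) with hw'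
  have key := slice_restrict (K := ℂ[X]) (s := srcX N m) (t := u) A B D (fun _ _ _ => rfl) w'
  set P : Matrix (J N m) (J N m) ℂ[X] := slice u w' with hP
  -- (1) the right-hand side is singular
  have hdet0 : P.det = 0 := by
    rw [key, Matrix.det_mul, Matrix.det_mul, det_sliceX_eq_zero hN hm, mul_zero, zero_mul]
  -- (2) the coefficients of `P` up to order `h`: `P = ε^h (1 + ε E)`
  have hcoeff : ∀ a c, ∀ j ≤ h,
      (P a c).coeff j = if j = h then (1 : Matrix (J N m) (J N m) ℂ) a c else 0 := by
    intro a c j hj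
    rw [hP, slice_apply, Polynomial.finsetSum_coeff]
    have hterm : ∀ b, (w' b * u a b c).coeff j =
        idWeight N m b * (if j = h then tgt N m a b c else 0) := by
      intro b
      rw [hw', Polynomial.coeff_C_mul, hcoeff_u a b c j hj]
    simp only [hterm]
    split_ifs with hjh
    · have h1 := congrFun (congrFun (slice_tgt_idWeight N m) a) c
      rw [slice_apply] at h1
      exact h1
    · simp
  have hdvd : ∀ a c, (X : ℂ[X]) ^ h ∣ P a c := fun a c =>
    Polynomial.X_pow_dvd_iff.mpr fun d hd => by rw [hcoeff a c d hd.le, if_neg hd.ne]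
  set Q : Matrix (J N m) (J N m) ℂ[X] := Matrix.of fun a c => P a c /ₘ ((X : ℂ[X]) ^ h) with hQ
  have hPQ : P = ((X : ℂ[X]) ^ h) • Q := by
    refine Matrix.ext fun a c => ?_
    rw [Matrix.smul_apply, hQ, Matrix.of_apply, smul_eq_mul]
    have h1 := Polynomial.modByMonic_add_div (P a c) ((X : ℂ[X]) ^ h)
    rw [(Polynomial.modByMonic_eq_zero_iff_dvd (Polynomial.monic_X_pow h)).mpr (hdvd a c),
      zero_add] at h1
    exact h1.symm
  have hQ0 : ∀ a c, (Q a c).coeff 0 = (1 : Matrix (J N m) (J N m) ℂ) a c := by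
    intro a c
    have h1 : (P a c).coeff (0 + h) = (Q a c).coeff 0 := by
      rw [hPQ, Matrix.smul_apply, smul_eq_mul, Polynomial.coeff_X_pow_mul]
    rw [← h1, zero_add, hcoeff a c h le_rfl, if_pos rfl]
  -- (3) `det Q` has constant coefficient `1`, so `det P = ε^{hn} det Q ≠ 0`
  have hdetQ : Q.det ≠ 0 := by
    intro h0
    have hmap : (Polynomial.constantCoeff : ℂ[X] →+* ℂ).mapMatrix Q = 1 := by
      refine Matrix.ext fun a c => ?_
      rw [RingHom.mapMatrix_apply, Matrix.map_apply, Polynomial.constantCoeff_apply, hQ0]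
    have h1 := RingHom.map_det (Polynomial.constantCoeff : ℂ[X] →+* ℂ) Q
    rw [h0, map_zero, hmap, Matrix.det_one] at h1
    exact zero_ne_one h1
  have hdetP : P.det ≠ 0 := by
    rw [hPQ, Matrix.det_smul]
    exact mul_ne_zero (pow_ne_zero _ (pow_ne_zero _ Polynomial.X_ne_zero)) hdetQ
  exact hdetP hdet0

/-- **The amortised BORDER exchange table starts at `m + 1`**: a degeneration
`⟨B⟩ ⊠ C₁^{⊠N} ⊵ ⟨m⟩ ⊠ ⟨2,2,2⟩^{⊠N}` with `N, m ≥ 1` forces `m + 1 ≤ B` (the gauge-point count gives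
`m ≤ B`, `not_tight_deg` excludes equality). [cite: CoppersmithWinograd1990, §7] -/
theorem succ_le_of_amortised_deg {B : ℕ} (hN : 1 ≤ N) (hm : 1 ≤ m)
    (h : AlgDegeneratesTo (kroneckerTensor (unitTensor ℂ B) (kroneckerPow coupling₁ N))
      (kroneckerTensor (unitTensor ℂ m) (kroneckerPow (matMulTensor ℂ 2 2 2) N))) :
    m + 1 ≤ B := by
  have hle : m ≤ B := le_of_amortised h
  rcases hle.lt_or_eq with hlt | heq
  · exact hlt
  · subst heq
    exact absurd h (not_tight_deg hN hm)

end Summit.MatrixMultiplication.MatrixMultiplication.Theorems.OutsiderSandwichNoTightBorder
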